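import Mathlib.RingTheory.Localization.AtPrime.Basic
import Mathlib.Algebra.MvPolynomial.Equiv
import Mathlib.RingTheory.MvPolynomial.Basic
import Mathlib.RingTheory.LocalRing.RingHom.Basic
import Mathlib.RingTheory.Ideal.Quotient.Operations
import Literature.AlgebraicGeometry.Resolution.ArithmeticalThreefoldsLocalProofs
import Summits.ResolutionOfSingularities.ResolutionOfSingularities.Theorems.WeightedInvariantHypersurfaceLocalGameEFTPointMoveExceptional
import HarnessLib

/-!
# The e.f.t. local weighted game (H2a′), dim-2 rung, case C II′: the axis order over ANY coefficient ring (Hasse route)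

Topic: `Summits/ResolutionOfSingularities/ResolutionOfSingularities/Theorems`. Helper for the door item
`HypersurfaceCentreConstruction` (statement `stmt-ResolutionOfSingularities-19897`, route `WeightedInvariant`), line
`local-engine` of `res-L1-w43-plan-1` (ORDER (o13), dim-2 rung of res-type-098's design memo
`L/res-type-098-w43/EFT-DIM2-DESIGN.md` v2 §B, `ι = iotaOrd`). SIBLING of kernel **K3b-ii**
`…EFTDimTwoAxisOrder` (res-D-pv-036, p509317: the §B literal `[Field κ]`, `Localization.AtPrime 𝔫̄`, via regular
local rings and `adicOrder`) — this file is the instance-free entry for the consumers K3b-iii / K7: ANY coefficient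
ring `R` (so it applies to `LocalGameEFTPointMove.rho`'s target `MvPolynomial (Fin d) (S ⧸ Ideal.span (Set.range u))`
with no `Field` glue), ANY localisation `[IsLocalization.AtPrime L P]` (so it applies to K3b-i's quotient
`B_𝔫 ⧸ (t⁻¹)`, `LocalGameEFTPointMove.isLocalization_quotient_span_tInv`, p508930), and the conclusion delivered in the
hypothesis shape `hz₁'` of `LocalGameEFTSubSlope.sum_monomial_not_mem_pow` (res-type-025). The §B literal itself is
NOT restated here (it is p509317's `LocalGameEFTPointMove.algebraMap_C_mul_X_pow_mul_X_pow_not_mem_pow`); hand res-D-pv-014.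

[OURS · L1 W4.3] Replaces the role of NO printed item; NOT a statement of the manuscript
[claim: Hironaka2017, status: under-review]. AI work, weaker than expert review.

## Content (pure polynomial algebra, no definitions, no regularity)

* `Polynomial.mem_of_mul_X_pow_mem_pow` — in `R[X]`, for an ideal `I ∋ X`: `a·Xʲ ∈ I^{j+1} ⇒ a ∈ I`. Proof: the
  `j`-th Hasse derivative lowers `I`-adic orders by at most `j` (`Polynomial.hasseDeriv_mem_pow`, tree), and by the
  higher Leibniz rule `D⁽ʲ⁾(a·Xʲ) = a + X·(…)`; characteristic-free (no `j!`).
* `mem_of_mul_X_pow_mem_pow` — the same in `MvPolynomial σ R` for a variable `X i ∈ I` (transport along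
  `MvPolynomial σ R ≃ (MvPolynomial {k // k ≠ i} R)[X]`, `X i ↦ X`, built inside the proof — no definitions).
* `algebraMap_mul_X_pow_not_mem_maximalIdeal_pow` — for a PRIME `P ∋ X i`, `a ∉ P`, and ANY localisation `L` of
  `MvPolynomial σ R` at `P`: the image of `a·(X i)ʲ` in `L` is in `𝔪_Lʲ` (`…_mem_maximalIdeal_pow`) and NOT in
  `𝔪_L^{j+1}`; in particular `X i ∉ 𝔪_L²` (`algebraMap_X_not_mem_maximalIdeal_sq`), and with a unit constant:
  `algebraMap_C_mul_X_pow_mul_X_pow_not_mem_maximalIdeal_pow_of_isUnit` (`C c * X i₀ ^ i * X i₁ ^ j`, `c` a unit,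
  `X i₁ ∈ P`, `X i₀ ∉ P`).
* bridges — **`mk_not_mem_map_maximalIdeal_sq`** / `mk_not_mem_map_maximalIdeal_pow`: for a local `A` (= K3b-i's
  `L ≅ B_𝔫`) and an ideal `I` (= `(t⁻¹)`) such that `A ⧸ I` is a localisation of `R[X_σ]` at `P` (= `nbar 𝔫`) and
  `mk z = algebraMap _ (A ⧸ I) (X i)` (K3b-i: `z = uT 1` via `psi_rho`/`rho_uT`): `mk z ∉ ((maximalIdeal A).map mk)²`
  — verbatim the hypothesis `hz₁'` of `sum_monomial_not_mem_pow`; plus the iso-invariance lemmas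
  `mem_maximalIdeal_pow_iff_of_ringEquiv` / `mk_mem_map_maximalIdeal_pow_iff_of_ringEquiv`.
* in K3b-i's own setting (`S`, `u`, `w`, `hu`, `hd`, `hw`, `𝔫 ∋ t⁻¹`, abstract `L`):
  **`mk_algebraMap_uT_not_mem_map_maximalIdeal_sq`** — `uᵢ' mod t⁻¹ ∉ (𝔪_L.map mk)²` whenever `Xᵢ ∈ nbar 𝔫`, and
  `mk_algebraMap_not_mem_map_maximalIdeal_pow_of_rho_eq` — the class of any `b` with `rho b = a·Xᵢʲ`, `a ∉ nbar 𝔫`,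
  is outside `(𝔪_L.map mk)^{j+1}`; the glue (`psi`-algebra, `isLocalization_quotient_span_tInv`, `psi_rho`) is
  done here once, so K3b-iii can call these BY NAME next to `adicOrder_tInv_eq_one` (`hz₂'`).

## References

* A. Grothendieck, ÉGA IV₄, Thm. 16.11.2 (the Hasse–Schmidt operators `D_p`, `D_p(z^q) = (q choose p) z^{q−p}`,
  higher Leibniz rule). [EGAIV4]
* O. Zariski, P. Samuel, *Commutative Algebra* II, Ch. VIII §1 (orders along an ideal). [ZariskiSamuel1960]
-/

set_option linter.dupNamespace false -- mandated namespace of this single-conjunct summit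

namespace Summit.ResolutionOfSingularities.ResolutionOfSingularities.Theorems

namespace LocalGameEFTAxisOrder

open IsLocalRing Literature.AlgebraicGeometry.Resolution

universe u v w

/-! ## One variable: `a·Xʲ ∈ I^{j+1} ⇒ a ∈ I` for `X ∈ I ⊆ R[X]` -/

section OneVariable

open Polynomial

variable {R : Type u} [CommRing R]

/-- **Hasse-derivative extraction of the cofactor**: in `R[X]` (any commutative ring `R`), if an ideal `I`
contains `X` and `a · X ^ j ∈ I ^ (j + 1)`, then `a ∈ I`. Indeed `D⁽ʲ⁾(a Xʲ) ∈ I` (Hasse derivatives lower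
`I`-adic orders by at most their order) and `D⁽ʲ⁾(a Xʲ) = a + Σ_{l<j} D⁽ʲ⁻ˡ⁾(a) · (j choose l) · X^{j−l} ∈ a + I`.
[cite: EGAIV4, Thm. 16.11.2 ((16.11.2.1)–(16.11.2.2): D_p(z^q) = (q choose p) z^{q-p}, Leibniz)] -/
theorem Polynomial.mem_of_mul_X_pow_mem_pow {I : Ideal R[X]} (hX : (X : R[X]) ∈ I) {a : R[X]} {j : ℕ}
    (h : a * X ^ j ∈ I ^ (j + 1)) : a ∈ I := by
  -- `D⁽ʲ⁾(a Xʲ) ∈ I`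
  have hD : hasseDeriv j (a * X ^ j) ∈ I := by
    have := Polynomial.hasseDeriv_mem_pow h j
    rwa [Nat.add_sub_cancel_left, pow_one] at this
  -- Leibniz: the `(0, j)` term is `a`, every other term is a multiple of `X`
  have h0 : ((0 : ℕ), j) ∈ Finset.HasAntidiagonal.antidiagonal j := by simp
  have hmain : hasseDeriv 0 a * hasseDeriv j (X ^ j : R[X]) = a := by
    rw [hasseDeriv_zero', X_pow_eq_monomial, hasseDeriv_monomial, Nat.sub_self, Nat.choose_self,
      Nat.cast_one, one_mul, monomial_zero_one, mul_one]
  have hrest : ∀ p ∈ (Finset.HasAntidiagonal.antidiagonal j).erase ((0 : ℕ), j),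
      hasseDeriv p.1 a * hasseDeriv p.2 (X ^ j : R[X]) ∈ I := by
    intro p hp
    obtain ⟨hne, hp'⟩ := Finset.mem_erase.mp hp
    rw [Finset.HasAntidiagonal.mem_antidiagonal] at hp'
    have hlt : p.2 < j := by
      by_contra hge
      apply hne
      have h2 : p.2 = j := by omega
      have h1 : p.1 = 0 := by omega
      exact Prod.ext h1 h2
    refine Ideal.mul_mem_left _ _ ?_
    rw [X_pow_eq_monomial, hasseDeriv_monomial, show j - p.2 = (j - p.2 - 1) + 1 by omega,
      ← monomial_mul_X]
    exact Ideal.mul_mem_left _ _ hX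
  have hsplit : a = hasseDeriv j (a * X ^ j) -
      ∑ p ∈ (Finset.HasAntidiagonal.antidiagonal j).erase ((0 : ℕ), j), hasseDeriv p.1 a * hasseDeriv p.2 (X ^ j : R[X]) := by
    rw [hasseDeriv_mul, ← Finset.add_sum_erase _ _ h0, hmain]
    ring
  rw [hsplit]
  exact Ideal.sub_mem _ hD (Ideal.sum_mem _ hrest)

/-- Contrapositive form: `X ∈ I`, `a ∉ I` ⇒ `a · X ^ j ∉ I ^ (j + 1)`. [cite: EGAIV4, Thm. 16.11.2] -/
theorem Polynomial.mul_X_pow_not_mem_pow {I : Ideal R[X]} (hX : (X : R[X]) ∈ I) {a : R[X]} (ha : a ∉ I)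
    (j : ℕ) : a * X ^ j ∉ I ^ (j + 1) :=
  fun h => ha (Polynomial.mem_of_mul_X_pow_mem_pow hX h)

end OneVariable

/-! ## Several variables: `a·(X i)ʲ ∈ I^{j+1} ⇒ a ∈ I` for `X i ∈ I ⊆ R[X_σ]` -/

section SeveralVariables

open MvPolynomial

variable {R : Type u} [CommRing R] {σ : Type v}

/-- **Several-variable form**: in `MvPolynomial σ R` (any commutative ring `R`), if an ideal `I` contains the
variable `X i` and `a · (X i) ^ j ∈ I ^ (j + 1)`, then `a ∈ I` (transport of the one-variable statement along
`R[X_σ] ≃ (R[X_{σ∖{i}}])[X]`, `X i ↦ X`). [cite: EGAIV4, Thm. 16.11.2] -/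
theorem mem_of_mul_X_pow_mem_pow {I : Ideal (MvPolynomial σ R)} {i : σ} (hX : X i ∈ I)
    {a : MvPolynomial σ R} {j : ℕ} (h : a * X i ^ j ∈ I ^ (j + 1)) : a ∈ I := by
  classical
  -- the isomorphism `R[X_σ] ≃ (R[X_{σ∖{i}}])[X]` singling out the variable `X i ↦ X`
  set f : MvPolynomial σ R ≃+* Polynomial (MvPolynomial {k // k ≠ i} R) :=
    ((renameEquiv R (Equiv.optionSubtypeNe i).symm).trans (optionEquivLeft R {k // k ≠ i})).toRingEquiv
    with hf
  have hfX : f (X i) = Polynomial.X := by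
    simp [hf]
  -- the image ideal `I' = f(I)` contains `X`, and `f a · X ^ j ∈ I' ^ (j + 1)`
  have hX' : (Polynomial.X : Polynomial (MvPolynomial {k // k ≠ i} R)) ∈ I.map f := by
    rw [← hfX]
    exact Ideal.mem_map_of_mem _ hX
  have h' : f a * Polynomial.X ^ j ∈ (I.map f) ^ (j + 1) := by
    rw [← Ideal.map_pow, ← hfX, ← map_pow, ← map_mul]
    exact Ideal.mem_map_of_mem _ h
  exact Ideal.apply_mem_of_equiv_iff.mp (Polynomial.mem_of_mul_X_pow_mem_pow hX' h')

/-- Contrapositive form: `X i ∈ I`, `a ∉ I` ⇒ `a · (X i) ^ j ∉ I ^ (j + 1)`. [cite: EGAIV4, Thm. 16.11.2] -/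
theorem mul_X_pow_not_mem_pow {I : Ideal (MvPolynomial σ R)} {i : σ} (hX : X i ∈ I)
    {a : MvPolynomial σ R} (ha : a ∉ I) (j : ℕ) : a * X i ^ j ∉ I ^ (j + 1) :=
  fun h => ha (mem_of_mul_X_pow_mem_pow hX h)

/-- The easy half: `a · (X i) ^ j ∈ I ^ j` when `X i ∈ I`. [folklore] -/
theorem mul_X_pow_mem_pow {I : Ideal (MvPolynomial σ R)} {i : σ} (hX : X i ∈ I)
    (a : MvPolynomial σ R) (j : ℕ) : a * X i ^ j ∈ I ^ j :=
  Ideal.mul_mem_left _ a (Ideal.pow_mem_pow hX j)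

/-! ## At a prime: `ord_P(a · (X i)ʲ) = j` in ANY localisation `L` of `R[X_σ]` at `P` -/

variable {P : Ideal (MvPolynomial σ R)} [P.IsPrime]
  (L : Type w) [CommRing L] [Algebra (MvPolynomial σ R) L] [IsLocalization.AtPrime L P] [IsLocalRing L]

/-- **Upper bound** (abstract localisation `L` of `R[X_σ]` at `P`, e.g. `Localization.AtPrime P`, or a quotient
`B_𝔫/(t⁻¹)` carrying an `IsLocalization.AtPrime` structure as in `LocalGameEFTPointMove.isLocalization_quotient_span_tInv`):
the image of `a · (X i) ^ j` lies in `𝔪_L ^ j` when `X i ∈ P`. [folklore] -/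
theorem algebraMap_mul_X_pow_mem_maximalIdeal_pow {i : σ} (hX : X i ∈ P) (a : MvPolynomial σ R) (j : ℕ) :
    algebraMap (MvPolynomial σ R) L (a * X i ^ j) ∈ maximalIdeal L ^ j := by
  rw [← IsLocalization.AtPrime.map_eq_maximalIdeal P L, ← Ideal.map_pow]
  exact Ideal.mem_map_of_mem _ (mul_X_pow_mem_pow hX a j)

/-- **The axis order** (kernel K3b-ii, abstract localisation): for a prime `P ∋ X i` of `MvPolynomial σ R`,
`a ∉ P`, and ANY localisation `L` of `MvPolynomial σ R` at `P`, the image of `a · (X i) ^ j` in `L` is NOT in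
`𝔪_L ^ (j + 1)` — so its `𝔪_L`-adic order is exactly `j`; `X i` is a regular parameter and `a` a unit of `L`.
(Pull back along `R[X] → L`: some `s ∉ P` has `s a · (X i)ʲ ∈ P^{j+1}`, hence `s a ∈ P` by
`mem_of_mul_X_pow_mem_pow`, contradicting primality.) [cite: ZariskiSamuel1960, Ch. VIII §1 (order of an element along an ideal)] -/
theorem algebraMap_mul_X_pow_not_mem_maximalIdeal_pow {i : σ} (hX : X i ∈ P) {a : MvPolynomial σ R}
    (ha : a ∉ P) (j : ℕ) :
    algebraMap (MvPolynomial σ R) L (a * X i ^ j) ∉ maximalIdeal L ^ (j + 1) := by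
  intro h
  rw [← IsLocalization.AtPrime.map_eq_maximalIdeal P L, ← Ideal.map_pow,
    IsLocalization.algebraMap_mem_map_algebraMap_iff P.primeCompl] at h
  obtain ⟨s, hs, hsa⟩ := h
  have hsa' : (s * a) * X i ^ j ∈ P ^ (j + 1) := by rwa [mul_assoc]
  have hmem : s * a ∈ P := mem_of_mul_X_pow_mem_pow hX hsa'
  exact (‹P.IsPrime›.mem_or_mem hmem).elim hs ha

/-- In particular `X i ∉ 𝔪_L²` for a prime `P ∋ X i` and any localisation `L` at `P`: `X i` is a regular
parameter of the local ring at `P`. [cite: ZariskiSamuel1960, Ch. VIII §1] -/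
theorem algebraMap_X_not_mem_maximalIdeal_sq {i : σ} (hX : X i ∈ P) :
    algebraMap (MvPolynomial σ R) L (X i) ∉ maximalIdeal L ^ 2 := by
  have h1 : (1 : MvPolynomial σ R) ∉ P := fun h => ‹P.IsPrime›.ne_top ((Ideal.eq_top_iff_one _).mpr h)
  simpa using algebraMap_mul_X_pow_not_mem_maximalIdeal_pow L hX h1 1

omit [IsLocalization.AtPrime L P] [IsLocalRing L] in
/-- A unit constant times a power of a variable outside the prime is outside the prime. [folklore] -/
theorem C_mul_X_pow_not_mem {c : R} (hc : IsUnit c) {i₀ : σ} (h0 : X i₀ ∉ P) (n : ℕ) :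
    C c * X i₀ ^ n ∉ P := by
  intro h
  rw [Ideal.unit_mul_mem_iff_mem _ (hc.map C)] at h
  exact h0 (‹P.IsPrime›.mem_of_pow_mem n h)

/-- **K3b-ii, unit-coefficient form** (any coefficient ring, any localisation): for a prime `𝔫̄` of
`MvPolynomial σ R` with `X i₁ ∈ 𝔫̄`, `X i₀ ∉ 𝔫̄` and a unit `c`, the image of `C c * X i₀ ^ i * X i₁ ^ j` in a
localisation `L` at `𝔫̄` is not in `𝔪_L ^ (j + 1)` (its order is exactly `j`). [cite: ZariskiSamuel1960, Ch. VIII §1] -/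
theorem algebraMap_C_mul_X_pow_mul_X_pow_not_mem_maximalIdeal_pow_of_isUnit {i₀ i₁ : σ}
    (h1 : X i₁ ∈ P) (h0 : X i₀ ∉ P) {c : R} (hc : IsUnit c) (i j : ℕ) :
    algebraMap (MvPolynomial σ R) L (C c * X i₀ ^ i * X i₁ ^ j) ∉ maximalIdeal L ^ (j + 1) :=
  algebraMap_mul_X_pow_not_mem_maximalIdeal_pow L h1 (C_mul_X_pow_not_mem hc h0 i) j

end SeveralVariables

/-! ## Bridges to K3b-i (`B_𝔫/(t⁻¹)` a localisation of `κ[X]` at `nbar`, p508930) and K3b-iii's hypothesis shape -/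

section Bridge

/-- Membership in powers of the maximal ideal is invariant under ring isomorphisms of local rings.
[folklore] -/
theorem mem_maximalIdeal_pow_iff_of_ringEquiv {A : Type u} {B : Type v} [CommRing A] [CommRing B]
    [IsLocalRing A] [IsLocalRing B] (e : A ≃+* B) (x : A) (n : ℕ) :
    x ∈ maximalIdeal A ^ n ↔ e x ∈ maximalIdeal B ^ n := by
  rw [← IsLocalRing.map_ringEquiv_maximalIdeal e, ← Ideal.map_pow, Ideal.apply_mem_of_equiv_iff]

/-- Quotient form of the bridge, in the hypothesis shape of `LocalGameEFTSubSlope.sum_monomial_not_mem_pow`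
(`z̄ ∈ (𝔪.map mk)ⁿ` in `A ⧸ I`): if `e : A ⧸ I ≃+* B` with `B` local, then
`mk z ∈ ((maximalIdeal A).map mk) ^ n ↔ e (mk z) ∈ (maximalIdeal B) ^ n`. With `A = B_𝔫`, `I = (t⁻¹)`,
`B = κ[X]_{𝔫̄}`, `e = e𝔫` and `e𝔫 (mk (uT 1)) = algebraMap (X 1)`, the right-hand side for `n = 2` is refuted by
`algebraMap_X_not_mem_maximalIdeal_sq`. [folklore] -/
theorem mk_mem_map_maximalIdeal_pow_iff_of_ringEquiv {A : Type u} {B : Type v} [CommRing A] [CommRing B]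
    [IsLocalRing A] [IsLocalRing B] (I : Ideal A) (e : (A ⧸ I) ≃+* B) (z : A) (n : ℕ) :
    Ideal.Quotient.mk I z ∈ ((maximalIdeal A).map (Ideal.Quotient.mk I)) ^ n ↔
      e (Ideal.Quotient.mk I z) ∈ maximalIdeal B ^ n := by
  haveI : IsLocalRing (A ⧸ I) := e.symm.isLocalRing
  rw [IsLocalRing.map_maximalIdeal_of_surjective _ Ideal.Quotient.mk_surjective]
  exact mem_maximalIdeal_pow_iff_of_ringEquiv e _ n

/-- **K3b-ii in the hypothesis shape of `LocalGameEFTSubSlope.sum_monomial_not_mem_pow`** (`hz₁'` there): let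
`A` be a local ring (K3b-i: any localisation `L ≅ B_𝔫`), `I` an ideal with `A ⧸ I` local and carrying an algebra
structure that makes it a localisation of `MvPolynomial σ R` at a prime `P ∋ X i` (K3b-i:
`I = (t⁻¹)`, the algebra of `psi`, instance `LocalGameEFTPointMove.isLocalization_quotient_span_tInv` with
`P = nbar 𝔫`), and `z : A` with `mk z = algebraMap _ (A ⧸ I) (X i)` (K3b-i: `z = uT i` by `psi_rho`, `rho_uT`).
Then `mk z ∉ ((maximalIdeal A).map mk) ^ 2`. [cite: ZariskiSamuel1960, Ch. VIII §1] -/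
theorem mk_not_mem_map_maximalIdeal_sq {R : Type u} [CommRing R] {σ : Type v} {P : Ideal (MvPolynomial σ R)}
    [P.IsPrime] {A : Type w} [CommRing A] [IsLocalRing A] (I : Ideal A) [IsLocalRing (A ⧸ I)]
    [Algebra (MvPolynomial σ R) (A ⧸ I)] [IsLocalization.AtPrime (A ⧸ I) P] {i : σ} (hX : MvPolynomial.X i ∈ P)
    {z : A} (hz : Ideal.Quotient.mk I z = algebraMap (MvPolynomial σ R) (A ⧸ I) (MvPolynomial.X i)) :
    Ideal.Quotient.mk I z ∉ ((maximalIdeal A).map (Ideal.Quotient.mk I)) ^ 2 := by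
  rw [IsLocalRing.map_maximalIdeal_of_surjective _ Ideal.Quotient.mk_surjective, hz]
  exact algebraMap_X_not_mem_maximalIdeal_sq (A ⧸ I) hX

/-- The same for a general monomial `a · (X i) ^ j`, `a ∉ P`: `mk z ∉ ((maximalIdeal A).map mk) ^ (j + 1)` whenever
`mk z = algebraMap _ (A ⧸ I) (a * X i ^ j)`. [cite: ZariskiSamuel1960, Ch. VIII §1] -/
theorem mk_not_mem_map_maximalIdeal_pow {R : Type u} [CommRing R] {σ : Type v} {P : Ideal (MvPolynomial σ R)}
    [P.IsPrime] {A : Type w} [CommRing A] [IsLocalRing A] (I : Ideal A) [IsLocalRing (A ⧸ I)]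
    [Algebra (MvPolynomial σ R) (A ⧸ I)] [IsLocalization.AtPrime (A ⧸ I) P] {i : σ} (hX : MvPolynomial.X i ∈ P)
    {a : MvPolynomial σ R} (ha : a ∉ P) (j : ℕ) {z : A}
    (hz : Ideal.Quotient.mk I z = algebraMap (MvPolynomial σ R) (A ⧸ I) (a * MvPolynomial.X i ^ j)) :
    Ideal.Quotient.mk I z ∉ ((maximalIdeal A).map (Ideal.Quotient.mk I)) ^ (j + 1) := by
  rw [IsLocalRing.map_maximalIdeal_of_surjective _ Ideal.Quotient.mk_surjective, hz]
  exact algebraMap_mul_X_pow_not_mem_maximalIdeal_pow (A ⧸ I) hX ha j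

end Bridge

/-! ## In the setting of K3b-i (p508930): the hypothesis `hz₁'` of `sum_monomial_not_mem_pow` for `z₁ = uᵢ'`, `z₂ = t⁻¹` -/

section PointMove

open LocalGameEFTPointMove

variable {S : Type} [CommRing S] [IsRegularLocalRing S] {d : ℕ} (u : Fin d → S) (w : Fin d → ℕ)
  (hu : Ideal.span (Set.range u) = maximalIdeal S) (hd : (maximalIdeal S).spanFinrank = d) (hw : ∀ i, 0 < w i)
  (𝔫 : Ideal (extReesAlgebra (weightedMonomialIdeal u w))) [𝔫.IsPrime]
  (hT : extReesAlgebra.tInv (weightedMonomialIdeal u w) ∈ 𝔫)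
  (L : Type) [CommRing L] [Algebra (extReesAlgebra (weightedMonomialIdeal u w)) L]
  [IsLocalization.AtPrime L 𝔫] [IsLocalRing L]

include hT in
/-- **Case-C input `hz₁'` at a successor point** (K3b-i + the axis order): `S` regular local, `u` a regular system
of parameters with positive weights `w`, `B = S[t⁻¹, 𝒥ₙtⁿ]`, `𝔫 ∋ t⁻¹` a prime of `B`, `L` any localisation of `B` at
`𝔫` (K3b-i's abstract `[IsLocalization.AtPrime L 𝔫]`), and `b ∈ B` whose exceptional-chart image is
`rho b = a · Xᵢʲ` with `Xᵢ ∈ nbar 𝔫 ∌ a`. Then, in `L ⧸ (t⁻¹)`, the class of `b` is NOT in `(𝔪_L.map mk) ^ (j + 1)`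
— the shape of the hypothesis `hz₁'` of `LocalGameEFTSubSlope.sum_monomial_not_mem_pow` (with `z₂ = t⁻¹`, whose
`hz₂'` is K3b-i's `adicOrder_tInv_eq_one`). Glue: `psi`-algebra + `isLocalization_quotient_span_tInv` +
`mk_not_mem_map_maximalIdeal_pow`. [cite: ZariskiSamuel1960, Ch. VIII §1] -/
theorem mk_algebraMap_not_mem_map_maximalIdeal_pow_of_rho_eq
    (b : extReesAlgebra (weightedMonomialIdeal u w)) {a : MvPolynomial (Fin d) (S ⧸ Ideal.span (Set.range u))}
    (ha : a ∉ nbar u w hu hd hw 𝔫) {i : Fin d} (hXi : MvPolynomial.X i ∈ nbar u w hu hd hw 𝔫) (j : ℕ)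
    (hb : rho u w hu hd hw b = a * MvPolynomial.X i ^ j) :
    Ideal.Quotient.mk (Ideal.span {algebraMap _ L (extReesAlgebra.tInv (weightedMonomialIdeal u w))})
        (algebraMap _ L b) ∉
      ((maximalIdeal L).map (Ideal.Quotient.mk
        (Ideal.span {algebraMap _ L (extReesAlgebra.tInv (weightedMonomialIdeal u w))}))) ^ (j + 1) := by
  haveI := nbar_isPrime u w hu hd hw 𝔫 hT
  letI := (psi u w hu hd hw L).toAlgebra
  haveI := isLocalization_quotient_span_tInv u w hu hd hw 𝔫 L (nbar u w hu hd hw 𝔫)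
    (comap_rho_nbar u w hu hd hw 𝔫 hT).symm
  haveI : IsLocalRing (L ⧸ Ideal.span {algebraMap _ L (extReesAlgebra.tInv (weightedMonomialIdeal u w))}) :=
    (isRegularLocalRing_quotient_span_tInv u w hu hd hw 𝔫 hT L).toIsLocalRing
  refine mk_not_mem_map_maximalIdeal_pow (P := nbar u w hu hd hw 𝔫) _ hXi ha j ?_
  rw [RingHom.algebraMap_toAlgebra, ← hb, psi_rho]

include hT in
/-- **`uᵢ' mod t⁻¹ ∉ (𝔪_L/t⁻¹)²`** whenever `Xᵢ ∈ nbar 𝔫` — the hypothesis `hz₁'` of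
`LocalGameEFTSubSlope.sum_monomial_not_mem_pow` for `z₁ = uᵢ' = uᵢ t^{wᵢ}`, `z₂ = t⁻¹`, in every localisation `L` of
`B` at a prime `𝔫 ∋ t⁻¹` (case C of the dim-2 rung: `i = 1`, `Y′ ∈ 𝔫̄`). [cite: ZariskiSamuel1960, Ch. VIII §1] -/
theorem mk_algebraMap_uT_not_mem_map_maximalIdeal_sq (i : Fin d) (hXi : MvPolynomial.X i ∈ nbar u w hu hd hw 𝔫) :
    Ideal.Quotient.mk (Ideal.span {algebraMap _ L (extReesAlgebra.tInv (weightedMonomialIdeal u w))})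
        (algebraMap _ L (uT u w i)) ∉
      ((maximalIdeal L).map (Ideal.Quotient.mk
        (Ideal.span {algebraMap _ L (extReesAlgebra.tInv (weightedMonomialIdeal u w))}))) ^ 2 := by
  haveI := nbar_isPrime u w hu hd hw 𝔫 hT
  have h1 : (1 : MvPolynomial (Fin d) (S ⧸ Ideal.span (Set.range u))) ∉ nbar u w hu hd hw 𝔫 := fun h =>
    (nbar_isPrime u w hu hd hw 𝔫 hT).ne_top ((Ideal.eq_top_iff_one _).mpr h)
  exact mk_algebraMap_not_mem_map_maximalIdeal_pow_of_rho_eq u w hu hd hw 𝔫 hT L (uT u w i) h1 hXi 1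
    (by rw [rho_uT, one_mul, pow_one])

end PointMove

end LocalGameEFTAxisOrder

end Summit.ResolutionOfSingularities.ResolutionOfSingularities.Theorems
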